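import Literature.MathematicalPhysics.QuantumLattice.EmeryThreeBandGeneralPairForm
import Summits.Ventures.CertifiedManyBodySolver.Downfold.EmeryReferenceLevel
import HarnessLib

/-!
# HULL-ATLAS certificate seam: the CuO₄-window operator certificate `H^w[θ] − q₀·1 ⪰ 0` transfers to CONVEX COMBINATIONS of coupling vectors
# (zero-kit `_hq` certificates at hull points — the input shape of the T = 0 floor door AND of the T > 0 cap doors) — hubbard-box-p2 g17

Venture CertifiedManyBodySolver, crew hubbard-fast S2 (iv) «three-band Emery boxes» × this seat's row «box ⊂ hull of certified cells ⇒ word»; seat hubbard-box-p2 (g17);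
namespace `Summit.Ventures.CertifiedManyBodySolver.Downfold`.

WHY: the HULL-ATLAS words (`EmeryHullAtlasVertices*`, `EmeryBoxes<Obj>HullChordBandWord`) transfer the SCALAR floors `q₀/8 − μρ ≤ e(θ, ρ)` to hull points by concavity
of the energy. The T > 0 cap doors of hubbard-downfold-mod-4 / hubbard-box-p1 (`emeryCellPressure_tiltedCorner_le_of_cuO4Certificate`,
`holdsOn_emeryCellPressureCap_of_tiltedCuO4Certificates`) and the floor door itself consume the OPERATOR certificate
`(H^w_{W}[emeryInteraction θ] + 0 − q₀·1).PosSemidef`. This file shows that the operator certificate transfers too, with NO new kernel work: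
`θ ↦ H^w_Λ[emeryInteraction θ]` is LINEAR (the tree's general-pair form: `H^w_Λ[emeryInteraction θ] = Σ_a θ_a · emeryAtomGP w Λ a`), so for weights `λᵢ ≥ 0`
and certificates `H^w[θᵢ] + 0 − qᵢ·1 ⪰ 0` one gets `H^w[Σλᵢθᵢ] + 0 − (Σλᵢqᵢ)·1 = Σ λᵢ (H^w[θᵢ] + 0 − qᵢ·1) ⪰ 0` (§1–§2); with `Σλᵢ = 1` and tilted corners
`θᵢ = emeryLine s vᵢ + μᵢ·levelDir` the combination is `emeryLine s (Σλᵢvᵢ) + (Σλᵢμᵢ)·levelDir` (§3), i.e. exactly the `_hq` shape at the hull point with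
`Q₀ = Σλᵢq₀ᵢ`, `M = Σλᵢμᵢ` — the same `(Q₀, M)` the Jensen floor lemmas `atlasHull_vNNN_floorAt` carry. Consumers: every door that takes `hq`.
Everything PROVED (0 sorry, no new definition). HONEST FRAMING: bookkeeping of linearity; nothing new is certified; energy/pressure words only.
-/

noncomputable section

namespace Summit.Ventures.CertifiedManyBodySolver.Downfold

open Matrix Finset Literature.Probability.LatticeModels
open Literature.MathematicalPhysics.QuantumLattice ThermodynamicLimit
open scoped BigOperators ComplexOrder

/-! ## §1 Linearity of the reweighted window Hamiltonian in the coupling vector -/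

/-- **`θ ↦ H^w_Λ[emeryInteraction θ]` is linear**: a real combination of coupling vectors gives the same combination of window Hamiltonians (from the tree's
general-pair form `localHamiltonian_reweight_emeryInteraction_eq_generalPair` + `generalPairHamiltonian_emery_eq_sum`). [cite: ValentiStolzeHirschfeld1991, §II] [cite: PavariniEtAl2001, eq. (1)] -/
theorem localHamiltonian_reweight_emeryInteraction_sum_smul {ι : Type*} [Fintype ι] (w : Finset (Site 2) → ℝ) (Λ : Finset (Site 2))
    (c : ι → ℝ) (θ : ι → Fin 14 → ℝ) :
    ((⟨fun X => (w X : ℂ) • (emeryInteraction (∑ i, c i • θ i)).Φ X⟩ : FermionInteraction 2).localHamiltonian Λ) =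
      ∑ i, ((c i : ℝ) : ℂ) • ((⟨fun X => (w X : ℂ) • (emeryInteraction (θ i)).Φ X⟩ : FermionInteraction 2).localHamiltonian Λ) := by
  simp_rw [localHamiltonian_reweight_emeryInteraction_eq_generalPair, generalPairHamiltonian_emery_eq_sum]
  simp only [Finset.sum_apply, Pi.smul_apply, smul_eq_mul, Complex.ofReal_sum, Complex.ofReal_mul, Finset.sum_smul, Finset.smul_sum, smul_smul]
  rw [Finset.sum_comm]

/-! ## §2 PSD transfer to nonnegative combinations -/

/-- **The operator certificate transfers to nonnegative combinations**: `λᵢ ≥ 0`, `H^w_Λ[θᵢ] + 0 − qᵢ·1 ⪰ 0` for all `i` ⇒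
`H^w_Λ[Σλᵢθᵢ] + 0 − (Σλᵢqᵢ)·1 ⪰ 0` (linearity §1 + sums / nonnegative multiples of PSD operators). NO new kernel certificate. [cite: KullEtAl2024, §5.3] [cite: Anderson1951, eq. (2)] -/
theorem posSemidef_reweight_emeryInteraction_sum_smul {ι : Type*} [Fintype ι] (w : Finset (Site 2) → ℝ) (Λ : Finset (Site 2))
    (c : ι → ℝ) (hc : ∀ i, 0 ≤ c i) (θ : ι → Fin 14 → ℝ) (q : ι → ℝ)
    (h : ∀ i, (((⟨fun X => (w X : ℂ) • (emeryInteraction (θ i)).Φ X⟩ : FermionInteraction 2).localHamiltonian Λ) + (0 : FermionOp Λ) -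
      ((q i : ℝ) : ℂ) • (1 : FermionOp Λ)).PosSemidef) :
    ((((⟨fun X => (w X : ℂ) • (emeryInteraction (∑ i, c i • θ i)).Φ X⟩ : FermionInteraction 2).localHamiltonian Λ) + (0 : FermionOp Λ) -
      (((∑ i, c i * q i : ℝ)) : ℂ) • (1 : FermionOp Λ)).PosSemidef) := by
  have key : (((⟨fun X => (w X : ℂ) • (emeryInteraction (∑ i, c i • θ i)).Φ X⟩ : FermionInteraction 2).localHamiltonian Λ) + (0 : FermionOp Λ) -
      (((∑ i, c i * q i : ℝ)) : ℂ) • (1 : FermionOp Λ)) =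
      ∑ i, ((c i : ℝ) : ℂ) • ((((⟨fun X => (w X : ℂ) • (emeryInteraction (θ i)).Φ X⟩ : FermionInteraction 2).localHamiltonian Λ) + (0 : FermionOp Λ) -
        ((q i : ℝ) : ℂ) • (1 : FermionOp Λ))) := by
    rw [localHamiltonian_reweight_emeryInteraction_sum_smul, add_zero]
    simp only [add_zero, smul_sub, smul_smul, Complex.ofReal_sum, Complex.ofReal_mul, Finset.sum_sub_distrib, Finset.sum_smul]
  rw [key]
  exact Matrix.posSemidef_sum Finset.univ fun i _ => (h i).smul (Complex.zero_le_real.2 (hc i))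

/-! ## §3 The tilted-corner bookkeeping: convex combinations of `emeryLine s vᵢ + μᵢ·levelDir` -/

/-- **Convex combination of tilted corners**: `Σλᵢ = 1` ⇒ `Σ λᵢ·(emeryLine s vᵢ + μᵢ·levelDir) = emeryLine s (Σλᵢvᵢ) + (Σλᵢμᵢ)·levelDir` (linearity of `emeryLine s`). [folklore] -/
theorem sum_smul_emeryLine_add_levelDir {ι : Type*} [Fintype ι] (s : Fin 4 → ℝ) (c : ι → ℝ) (v : ι → Fin 6 → ℝ) (μ : ι → ℝ) :
    ∑ i, c i • (emeryLine s (v i) + μ i • levelDir) = emeryLine s (∑ i, c i • v i) + (∑ i, c i * μ i) • levelDir := by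
  simp only [smul_add, smul_smul, Finset.sum_add_distrib, map_sum, map_smul, Finset.sum_smul]

/-- **HULL CERTIFICATE (the `_hq` shape at a hull point)**: tilted-corner certificates `H^w_Λ[emeryLine s vᵢ + μᵢ·levelDir] + 0 − qᵢ·1 ⪰ 0` and weights
`λᵢ ≥ 0` (for the hull reading `Σλᵢ = 1`, not needed for the inequality) give `H^w_Λ[emeryLine s (Σλᵢvᵢ) + (Σλᵢμᵢ)·levelDir] + 0 − (Σλᵢqᵢ)·1 ⪰ 0` — the certificate the floor door
(`le_emeryEnergyDensity_of_posSemidef_uniform_levelShift`) and the T > 0 cap doors (`emeryCellPressure_tiltedCorner_le_of_cuO4Certificate`) consume, at ANY point of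
the convex hull of the certified library, with NO new kernel work. [cite: KullEtAl2024, §5.3] [cite: Anderson1951, eq. (2)] [cite: Rockafellar1970, Thm 32.2] -/
theorem posSemidef_hullPoint_of_tiltedCertificates {ι : Type*} [Fintype ι] (w : Finset (Site 2) → ℝ) (Λ : Finset (Site 2)) (s : Fin 4 → ℝ)
    (c : ι → ℝ) (hc : ∀ i, 0 ≤ c i) (v : ι → Fin 6 → ℝ) (μ q : ι → ℝ)
    (h : ∀ i, (((⟨fun X => (w X : ℂ) • (emeryInteraction (emeryLine s (v i) + μ i • levelDir)).Φ X⟩ : FermionInteraction 2).localHamiltonian Λ) +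
      (0 : FermionOp Λ) - ((q i : ℝ) : ℂ) • (1 : FermionOp Λ)).PosSemidef) :
    ((((⟨fun X => (w X : ℂ) • (emeryInteraction (emeryLine s (∑ i, c i • v i) + (∑ i, c i * μ i) • levelDir)).Φ X⟩ : FermionInteraction 2).localHamiltonian Λ) +
      (0 : FermionOp Λ) - (((∑ i, c i * q i : ℝ)) : ℂ) • (1 : FermionOp Λ)).PosSemidef) := by
  rw [← sum_smul_emeryLine_add_levelDir]
  exact posSemidef_reweight_emeryInteraction_sum_smul w Λ c hc _ q h

end Summit.Ventures.CertifiedManyBodySolver.Downfold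

end
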